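import Summits.HodgeConjecture.HodgeConjecture.Theorems.F0P6aRoofKernelCountRoofKernelCount
import HarnessLib

/-!
# `F0P6aRoofKernelCount` — ★ RE-HOME of `Lines/F0_P6a_RoofKernelCount.lean` (tree sha16 d2af81f90ec7d7e6), PART 2 of 2 — tree lines :337–:396 (LAST part: the module the `Lines/` shim and consumers import; it transitively carries parts 1–1).

See PART 1 `Theorems/F0P6aRoofKernelCountRoofKernelCount.lean` for the full ★ re-home header and the original module docstring (verbatim there).  Same namespace (every fully-qualified name unchanged);
the scopes open at the cut (`noncomputable section` ∕ `namespace` ∕ `section`s) are re-opened below with their `variable` ∕ `open` ∕ `set_option` ∕ `omit` ∕ `include` ∕ `universe` lines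
replayed verbatim from the tree, in order; the code after the replay block is the tree bytes :337–:396, untouched.  HC_CM is proved only modulo the 7 printed citations (2 remaining: hLiu418 = stmt-HodgeConjecture-24832, h413 = stmt-HodgeConjecture-24833) until rung 0 closes; a re-home is count-neutral.
-/

-- ── replay of the scopes open at tree line :337 (verbatim) ──
set_option autoImplicit false
set_option linter.dupNamespace false
noncomputable section
namespace Summit.HodgeConjecture.HodgeConjecture.Cruxes.HLiu418.F0P6aLineSpecialisation
open CategoryTheory CategoryTheory.Limits NumberField IsDedekindDomain MulAction AlgebraicGeometry
open scoped Matrix Pointwise MonObj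
open Literature.NumberTheory.GaloisRepresentations
open Literature.NumberTheory.Automorphic Literature.NumberTheory.Automorphic.UnitaryGroup
open Literature.AlgebraicGeometry.ShimuraVarieties.UnitaryCanonicalModel
open Literature.NumberTheory.Automorphic.Liu2021.AppendixC
open Literature.AlgebraicGeometry.Motives (AlgPoints IntegralModel SchemeOver thickening thickeningLift specOver)
open Literature.NumberTheory.DiophantineGeometry (geomResidueField)
open Literature.AlgebraicGeometry.RelativeSpec (ActionOver)
open Literature.NumberTheory.EllipticCurves (specGenericPoint)
open Literature.AlgebraicGeometry.AbelianSchemes Literature.AlgebraicGeometry.AbelianSchemes.AbelianSchemeOver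
open Summit.HodgeConjecture.HodgeConjecture.Cruxes.HLiu418.F0P6aModuliDatumDefs
open Summit.HodgeConjecture.HodgeConjecture.Cruxes.HLiu418.F0P6aRGDAssembly
open Summit.HodgeConjecture.HodgeConjecture.Cruxes.HLiu418.F0P6aDatumOfInputs
open Summit.HodgeConjecture.HodgeConjecture.Cruxes.HLiu418.F0P6cHeckeBacktrack (exists_line_quotΩ_quotΩ_eq_translΩ_of_hecke_of_hyperspecial)
section RoofKernelCount
variable {F : Type} [Field F] [NumberField F] [IsCMField F] {ι₁ : F →+* ℂ}
    {Jstar : Matrix (Fin 2) (Fin 2) F}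
    {K₀ : C5.OpenCompactSubgroup ↥(finAdelic ↥(maximalRealSubfield F) F (IsCMField.complexConj F) 2 Jstar)}
    {S : RecordSystemGS F Jstar ι₁ K₀} {hU7ₛ : S.HeckeTranslateDefinedOver}
    {hJ : (Jstar.map (IsCMField.complexConj F))ᵀ = Jstar} {hJu : IsUnit Jstar}
    {Fi : Type} [Field Fi] [Algebra F Fi] {Kc : C5.SmallLevel K₀} {G : Type} [Group G]
    {𝓜 : IntegralModel (𝓞 F) F ((thickening F Fi).obj (S.M.obj Kc))}
    {w : HeightOneSpectrum (𝓞 F)} {hw : (IsCMField.complexConj F) • w ≠ w} {h𝓨 : (𝓜.localise w).IsSmoothProper 1}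
    {θ : ActionOver (𝓜.localise w).total.hom ((Fi ≃ₐ[F] Fi) × G)}
    {e : Fi →ₐ[F] AlgebraicClosure (w.adicCompletion F)}
-- ── tree bytes :337–:396 ──

/-! ### (v3) ORGAN (ρ2‴)-D — the `w`-part of the roof kernel has `q` points -/

set_option maxHeartbeats 400000 in
/-- **THE ROOF KERNEL IS `ι`-STABLE** in datum currency (★ (ρ2″) ED. 3 `map_i_mem_of_roof` on the `RoofΩ` rows (r1), (r2), (r4)). [cite: MumfordAV1970, §7 Thm. 4 (p. 72)] -/
theorem roofKernel_stable (I : RGDInputsAt F ι₁ Jstar K₀ S hU7ₛ hJ hJu Fi Kc G 𝓜 w hw h𝓨 θ e)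
    (quotΩ : ∀ y, LineOf I y → AlgPoints (S.M.obj Kc) (AlgebraicClosure (w.adicCompletion F)))
    (y : AlgPoints (S.M.obj Kc) (AlgebraicClosure (w.adicCompletion F))) (L : LineOf I y)
    (K : Subgroup ((fibreΩOf S Kc 𝓜 w e I.univ y).Points (AlgebraicClosure (w.adicCompletion F))))
    (hR : RoofΩ S Kc 𝓜 w e I.univ I.act I.dual I.pol I.lvl I.pChar w.asIdeal y (quotΩ y L) K) :
    ∀ a : 𝓞 F, ∀ P ∈ K, (AlgPoints.map ((actΩROf I y).i a) P : (fibreΩOf S Kc 𝓜 w e I.univ y).Points (AlgebraicClosure (w.adicCompletion F))) ∈ K := by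
  obtain ⟨B, DB, lamB, hlamB, hDB, q, hq, c, hc, h1, h2, h2s, -, -, h4, -⟩ := hR
  haveI := hq; haveI := hc
  exact map_i_mem_of_roof (actΩROf I y) (actΩROf I (quotΩ y L)) q c w K h1 h2 h2s h4

set_option maxHeartbeats 400000 in
/-- **THE `w`-PART OF THE ROOF KERNEL HAS `q` POINTS**: for every kernel `K` served by `RoofLink I quotΩ` at `(y, L)`,
`#{P ∈ K | ι(𝔭_w) P = 1} = p^f` — the points-level CRT splitting ★ `natCard_eq_mul_of_idealTorsion_mul` (`K ⊆ A_y[𝔭_w𝔭_{c•w}]` by (ρ2″)-C, `K` `ι`-stable,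
`𝔭_w + 𝔭_{c•w} = (1)`) reads `#K = #K[𝔭_w] · #K[𝔭_{c•w}]`, with `#K = p^{2f}` ((ρ2‴)-C) and `K[𝔭_{c•w}] = L` of order `p^f` (`RoofLink`'s first clause, `LineOf`).
The (k2b)-PACK step (s3) input «`K ∩ A_y[𝔭_w](Ω̄)` has order `q`». [cite: Liu2021, Prop. D.8 (pp. 135–138)] [cite: AtiyahMacdonald1969, Prop. 1.10] -/
theorem natCard_roofKernel_inf_idealTorsionΩ_w_eq (I : RGDInputsAt F ι₁ Jstar K₀ S hU7ₛ hJ hJu Fi Kc G 𝓜 w hw h𝓨 θ e)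
    (quotΩ : ∀ y, LineOf I y → AlgPoints (S.M.obj Kc) (AlgebraicClosure (w.adicCompletion F)))
    (translΩ : AlgPoints (S.M.obj Kc) (AlgebraicClosure (w.adicCompletion F)) → AlgPoints (S.M.obj Kc) (AlgebraicClosure (w.adicCompletion F)))
    (hhecke : HeckeClause I quotΩ translΩ)
    (hunit : (UnitaryGroup.isUnit_placeForm Jstar hJu w).unit ∈ glInt 2 (w.adicCompletion F))
    (hKc : UnitaryGroup.IsHyperspecialAt ↥(maximalRealSubfield F) F (IsCMField.complexConj F) 2 Jstar Kc.1.1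
      (w.under (𝓞 ↥(maximalRealSubfield F))))
    (hroof : RoofLink I quotΩ) (hroof₂ : RoofLink₂ I translΩ)
    (hunr : ¬ (w.asIdeal ^ 2 ∣ Ideal.span {((I.pChar : ℕ) : 𝓞 F)}))
    (y : AlgPoints (S.M.obj Kc) (AlgebraicClosure (w.adicCompletion F))) (L : LineOf I y)
    (K : Subgroup ((fibreΩOf S Kc 𝓜 w e I.univ y).Points (AlgebraicClosure (w.adicCompletion F))))
    (hK : (∀ P, P ∈ L.1 ↔ P ∈ K ∧ IsIdealTorsionΩ S Kc 𝓜 w e I.univ I.act y ((IsCMField.complexConj F) • w).asIdeal P) ∧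
      RoofΩ S Kc 𝓜 w e I.univ I.act I.dual I.pol I.lvl I.pChar w.asIdeal y (quotΩ y L) K) :
    Nat.card {P : (fibreΩOf S Kc 𝓜 w e I.univ y).Points (AlgebraicClosure (w.adicCompletion F)) //
        P ∈ K ∧ IsIdealTorsionΩ S Kc 𝓜 w e I.univ I.act y w.asIdeal P} = I.pChar ^ I.fDeg := by
  haveI : IsCommMonObj (schΩOf S Kc 𝓜 w e I.univ y).X := (schΩOf S Kc 𝓜 w e I.univ y).isCommMonObj_of_isReduced_base
  have htors := isIdealTorsionΩ_mul_of_roofLink I quotΩ translΩ hhecke hunit hKc hroof hroof₂ hunr y L K hK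
  have hst := roofKernel_stable I quotΩ y L K hK.2
  have hne : w.asIdeal ≠ ((IsCMField.complexConj F) • w).asIdeal := fun h => hw (HeightOneSpectrum.ext h.symm)
  haveI : w.asIdeal.IsMaximal := w.isMaximal
  haveI : (((IsCMField.complexConj F) • w).asIdeal).IsMaximal := ((IsCMField.complexConj F) • w).isMaximal
  have h𝔭𝔮 : w.asIdeal ⊔ ((IsCMField.complexConj F) • w).asIdeal = ⊤ := Ideal.IsMaximal.coprime_of_ne inferInstance inferInstance hne
  have hsplit := RingAction.natCard_eq_mul_of_idealTorsion_mul (actΩROf I y) w.asIdeal (((IsCMField.complexConj F) • w).asIdeal) h𝔭𝔮 K htors hst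
  have hcount := natCard_roofKernel_eq I quotΩ translΩ hhecke hunit hKc hroof hroof₂ y L K hK
  have hL : Nat.card {P : (fibreΩOf S Kc 𝓜 w e I.univ y).Points (AlgebraicClosure (w.adicCompletion F)) //
      P ∈ K ∧ IsIdealTorsionΩ S Kc 𝓜 w e I.univ I.act y ((IsCMField.complexConj F) • w).asIdeal P} = I.pChar ^ I.fDeg := by
    rw [← L.2.1]
    exact Nat.card_congr (Equiv.subtypeEquivRight fun P => (hK.1 P).symm)
  have hq : 0 < I.pChar ^ I.fDeg := pow_pos I.hpChar.1.pos _
  have key : I.pChar ^ (2 * I.fDeg) = Nat.card {P : (fibreΩOf S Kc 𝓜 w e I.univ y).Points (AlgebraicClosure (w.adicCompletion F)) //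
      P ∈ K ∧ IsIdealTorsionΩ S Kc 𝓜 w e I.univ I.act y w.asIdeal P} * I.pChar ^ I.fDeg := by
    rw [← hcount, ← hL]
    exact hsplit
  rw [two_mul, pow_add] at key
  exact Nat.eq_of_mul_eq_mul_right hq key.symm

end RoofKernelCount

end Summit.HodgeConjecture.HodgeConjecture.Cruxes.HLiu418.F0P6aLineSpecialisation

end
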